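/-
Origin: expansion seat `prover-pub-hodgecm-mc-sinst-1-g3-0`, handover #1210 2026-08-20T05:02Z md5 328c30567f45 (189 l.) NEW additive drop-alone leaf after #1207; slot characters = big-pair plane-torus eigenvalues on the see-saw tensor of slot test vectors (plane + conjugated plane); drop alone on bounce (and with #1207); NAME LIST: HodgeCM.Model.ArchSideTerm.cmPairRep_planeTorus_lineTensorFin_testFun · HodgeCM.Model.ArchSideTerm.cmPairRep_conjPlaneTorus_lineTensorFin_testFun · HodgeCM.Model.ArchSideTerm.slotChi₀_apply) (`HOME/mc/pub-hodgecm-mc-sinst-1-g3/stage/HodgeCM/Model/ArchLineSlotTypeSeesaw.lean`, md5 328c30567f45, 189 lines);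
landed by the gen-15 packager (p-g15) in gate run 41 as `HodgeCM/Model/ArchLineSlotTypeSeesaw.lean` (verbatim).
-/
/-
Origin: speedrun cell pub-hodgecm, MODEL-CONSTRUCTION sub-cell, lineage mc-sinst-1 (S-instance constructor, BINDER-OWNERS row 5 `S`),
seat prover-pub-hodgecm-mc-sinst-1-g3-0 (gen 3), 2026-08-20.  Target in PKG: `HodgeCM/Model/ArchLineSlotTypeSeesaw.lean`
(NEW additive drop-alone leaf; RUN 42 material; imports `Model/ArchLineSlotType` (#1207) only).
KERNEL only: 0 records / `def … : Prop` / cites, 0 proof holes; intended closure {propext, Classical.choice, Quot.sound}.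
-/
import Summits.HodgeConjecture.HodgeCM.Model.ArchLineSlotType_2

/-!
# The slot characters ARE the big pair's torus eigenvalues (see-saw, operator level)

For (J-μ) only CHOICE-FREE integers can meet E's `μ`; the slot-wise read-offs `slotType (slotChiₖ · cₖ)` of #1207 each carry the
`ν ∘ det` ambiguity of the BIG splitting `hGR.choose` (the small splittings `hGRₖ.choose` have already cancelled in the product
`χₖ · cₖ`).  This leaf records WHERE these characters live for the census engines: by the tree's operator-level see-saw
(`UnitaryDualPairSeesawCMLines.cmPairRepTwist_torusIdeles_cmLineTensorFin`, [Howe1979 §3]) and the collapse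
`cmLineRepFin₀/₁_apply_eq_smul_cmPairRep` + centre swap, the plane torus `(1, diag(t₀, t₁)) ∈ U(V)(𝔸) × U(dW)(𝔸)` acts through
`ω_ψ ∘ s_pair(hGR)` on the see-saw tensor `φ_{N₀}(Φ₀) ⊗″ φ_{N₁}(Φ₁)` of two slot test vectors with centre eigen-characters `c₀, c₁`
by the scalar `(slotChi₀ · c₀)(t₀) · (slotChi₁ · c₁)(t₁)`:

* `cmPairRep_planeTorus_lineTensorFin_testFun` — the identity above (slots 0, 1; any `Φₖ, x₀ₖ, cₖ` with (D5-ctr)ₖ);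
* hence the slot types of #1207 are the archimedean exponents of ONE big-pair torus action on ONE vector — the input shape of
  binder-2's torus/letter engine (`HypCensus.TorusLetters`, `CompactLetters`), in which the per-place exponents are computed.

Nothing here is a claim of PerL/QW8; nothing is cited as a fact.
-/

set_option autoImplicit false

noncomputable section

open scoped Matrix Classical SchwartzMap
open Literature.NumberTheory.Automorphic Literature.NumberTheory.Weil1964
open Literature.NumberTheory.GelbartRogawski1991.UnitaryDualPair
open HodgeCM.Adelic HodgeCM.PerL34

namespace HodgeCM.Model.ArchSideTerm

section Plane

variable {L : CMField} {ι₁ : L →+* ℂ} (V : HermSpace3 L ι₁) (S : StubTree.SeesawDatum L)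
variable
  (hGR : (cmSplittingDatum (L : Type) finProdFinEquiv (frameD V) (frameD_real V) (frameD_ne V) (dW S) (dW_real S) (dW_ne S)).CompatibleSplitting)
  (hGR₀ : (cmSplittingDatum (L : Type) (e₁) (frameD V) (frameD_real V) (frameD_ne V) (lineVec (L : Type) (dW S 0))
    (fun _ => dW_real S 0) (fun _ => dW_ne S 0)).CompatibleSplitting)
  (hGR₁ : (cmSplittingDatum (L : Type) (e₁) (frameD V) (frameD_real V) (frameD_ne V) (lineVec (L : Type) (dW S 1))
    (fun _ => dW_real S 1) (fun _ => dW_ne S 1)).CompatibleSplitting)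

/-- `slotChi₀` unfolded (definitional). -/
theorem slotChi₀_apply (t : ↥(relNormOneInfUnits (↥(NumberField.maximalRealSubfield (L : Type))) (L : Type))) :
    slotChi₀ V S hGR hGR₀ hGR₁ t =
      ((cmLineChar₀ (L : Type) finProdFinEquiv e₁ (frameD V) (frameD_real V) (frameD_ne V) (dW S) (dW_real S) (dW_ne S) hGR hGR₀ hGR₁
        (1, CMCenter (L : Type) (lineVec (L : Type) (dW S 0))
          ((UnitaryGroup.cmAdelicOneEquivRelNormOne (L : Type)).symm (relNormOneInfToIdeles (↥(NumberField.maximalRealSubfield (L : Type))) (L : Type) t))) : ℂˣ) : ℂ) :=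
  rfl

/-- `slotChi₁` unfolded (definitional). -/
theorem slotChi₁_apply (t : ↥(relNormOneInfUnits (↥(NumberField.maximalRealSubfield (L : Type))) (L : Type))) :
    slotChi₁ V S hGR hGR₀ hGR₁ t =
      ((cmLineChar₁ (L : Type) finProdFinEquiv e₁ (frameD V) (frameD_real V) (frameD_ne V) (dW S) (dW_real S) (dW_ne S) hGR hGR₀ hGR₁
        (1, CMCenter (L : Type) (lineVec (L : Type) (dW S 1))
          ((UnitaryGroup.cmAdelicOneEquivRelNormOne (L : Type)).symm (relNormOneInfToIdeles (↥(NumberField.maximalRealSubfield (L : Type))) (L : Type) t))) : ℂˣ) : ℂ) :=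
  rfl

/-- **THE SLOT CHARACTERS ARE THE BIG PAIR'S TORUS EIGENVALUES** (slots 0 and 1): for slot test vectors `Φ₀, Φ₁` with centre
eigen-characters `c₀, c₁` ((D5-ctr)₀, (D5-ctr)₁ in the shape of `ArchLineDatum.hctr₀/₁`), the plane torus `(1, diag(t₀, t₁))` acts on
`φ_{N₀}(Φ₀) ⊗″ φ_{N₁}(Φ₁)` through `ω_ψ ∘ s_pair(hGR)` — the BIG splitting alone on the left — by `(slotChi₀·c₀)(t₀) · (slotChi₁·c₁)(t₁)`. -/
theorem cmPairRep_planeTorus_lineTensorFin_testFun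
    (Φ₀ Φ₁ : SchwartzMap (Fin 3 → NumberField.mixedEmbedding.mixedSpace (↥(NumberField.maximalRealSubfield (L : Type)))) ℂ)
    (x₀ x₁ : Fin 3 → ↥(NumberField.maximalRealSubfield (L : Type)))
    (c₀ c₁ : ↥(relNormOneInfUnits (↥(NumberField.maximalRealSubfield (L : Type))) (L : Type)) →* ℂ)
    (hctr₀ : ∀ (N : ℕ) (t : ↥(relNormOneInfUnits (↥(NumberField.maximalRealSubfield (L : Type))) (L : Type))),
      cmPairRep (L : Type) e₁ (frameD V) (frameD_real V) (frameD_ne V) (lineVec (L : Type) (dW S 0)) (fun _ => dW_real S 0)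
          (fun _ => dW_ne S 0) hGR₀
          (CMCenter (L : Type) (frameD V)
              ((UnitaryGroup.cmAdelicOneEquivRelNormOne (L : Type)).symm (relNormOneInfToIdeles (↥(NumberField.maximalRealSubfield (L : Type))) (L : Type) t)), 1)
          (SupplyInstance.testFun (↥(NumberField.maximalRealSubfield (L : Type))) (Fin 3) Φ₀ x₀ N) =
        c₀ t • SupplyInstance.testFun (↥(NumberField.maximalRealSubfield (L : Type))) (Fin 3) Φ₀ x₀ N)
    (hctr₁ : ∀ (N : ℕ) (t : ↥(relNormOneInfUnits (↥(NumberField.maximalRealSubfield (L : Type))) (L : Type))),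
      cmPairRep (L : Type) e₁ (frameD V) (frameD_real V) (frameD_ne V) (lineVec (L : Type) (dW S 1)) (fun _ => dW_real S 1)
          (fun _ => dW_ne S 1) hGR₁
          (CMCenter (L : Type) (frameD V)
              ((UnitaryGroup.cmAdelicOneEquivRelNormOne (L : Type)).symm (relNormOneInfToIdeles (↥(NumberField.maximalRealSubfield (L : Type))) (L : Type) t)), 1)
          (SupplyInstance.testFun (↥(NumberField.maximalRealSubfield (L : Type))) (Fin 3) Φ₁ x₁ N) =
        c₁ t • SupplyInstance.testFun (↥(NumberField.maximalRealSubfield (L : Type))) (Fin 3) Φ₁ x₁ N)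
    (N₀ N₁ : ℕ) (t₀ t₁ : ↥(relNormOneInfUnits (↥(NumberField.maximalRealSubfield (L : Type))) (L : Type))) :
    cmPairRep (L : Type) finProdFinEquiv (frameD V) (frameD_real V) (frameD_ne V) (dW S) (dW_real S) (dW_ne S) hGR
        (1, cmPlaneTorusIdeles (L : Type) (dW S)
          (relNormOneInfToIdeles (↥(NumberField.maximalRealSubfield (L : Type))) (L : Type) t₀,
            relNormOneInfToIdeles (↥(NumberField.maximalRealSubfield (L : Type))) (L : Type) t₁))
        (cmLineTensorFin (L : Type) finProdFinEquiv e₁ (frameD V) (frameD_real V) (frameD_ne V) (dW S) (dW_real S) (dW_ne S)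
          (SupplyInstance.testFun (↥(NumberField.maximalRealSubfield (L : Type))) (Fin 3) Φ₀ x₀ N₀)
          (SupplyInstance.testFun (↥(NumberField.maximalRealSubfield (L : Type))) (Fin 3) Φ₁ x₁ N₁)) =
      ((slotChi₀ V S hGR hGR₀ hGR₁ * c₀) t₀ * (slotChi₁ V S hGR hGR₀ hGR₁ * c₁) t₁) •
        cmLineTensorFin (L : Type) finProdFinEquiv e₁ (frameD V) (frameD_real V) (frameD_ne V) (dW S) (dW_real S) (dW_ne S)
          (SupplyInstance.testFun (↥(NumberField.maximalRealSubfield (L : Type))) (Fin 3) Φ₀ x₀ N₀)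
          (SupplyInstance.testFun (↥(NumberField.maximalRealSubfield (L : Type))) (Fin 3) Φ₁ x₁ N₁) := by
  have h := cmPairRepTwist_torusIdeles_cmLineTensorFin (L : Type) finProdFinEquiv e₁ (frameD V) (frameD_real V) (frameD_ne V)
    (dW S) (dW_real S) (dW_ne S) hGR hGR₀ hGR₁ 1 1 1 (fun _ _ _ => by rw [MonoidHom.one_apply, MonoidHom.one_apply,
      MonoidHom.one_apply, one_mul]) 1
    (relNormOneInfToIdeles (↥(NumberField.maximalRealSubfield (L : Type))) (L : Type) t₀)
    (relNormOneInfToIdeles (↥(NumberField.maximalRealSubfield (L : Type))) (L : Type) t₁)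
    (SupplyInstance.testFun (↥(NumberField.maximalRealSubfield (L : Type))) (Fin 3) Φ₀ x₀ N₀)
    (SupplyInstance.testFun (↥(NumberField.maximalRealSubfield (L : Type))) (Fin 3) Φ₁ x₁ N₁)
  rw [cmPairRepTwist_apply_eq_smul, MonoidHom.one_apply, Units.val_one, one_smul] at h
  rw [h, cmLineRepFin₀_apply_eq_smul_cmPairRep, cmLineRepFin₁_apply_eq_smul_cmPairRep, cmPairRep_one_center',
    cmPairRep_one_center', hctr₀, hctr₁, smul_smul, smul_smul, LinearMap.map_smul₂, LinearMap.map_smul, smul_smul]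
  congr 1
  rw [Units.val_mul, Units.val_mul, MonoidHom.one_apply, MonoidHom.one_apply, Units.val_one, one_mul, one_mul,
    MonoidHom.mul_apply, MonoidHom.mul_apply, slotChi₀_apply, slotChi₁_apply]

end Plane

section ConjPlane

variable {L : CMField} {ι₁ : L →+* ℂ} (V : HermSpace3 L ι₁) (S : StubTree.SeesawDatum L)
variable
  (hGR : (cmSplittingDatum (L : Type) finProdFinEquiv (frameD V) (frameD_real V) (frameD_ne V) (dW S) (dW_real S) (dW_ne S)).CompatibleSplitting)
  (hGR₂ : (cmSplittingDatum (L : Type) (e₁) (frameD V) (frameD_real V) (frameD_ne V) (lineVec (L : Type) (dW' S 0))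
    (fun _ => dW'_real S 0) (fun _ => dW'_ne S 0)).CompatibleSplitting)
  (hGR₃ : (cmSplittingDatum (L : Type) (e₁) (frameD V) (frameD_real V) (frameD_ne V) (lineVec (L : Type) (dW' S 1))
    (fun _ => dW'_real S 1) (fun _ => dW'_ne S 1)).CompatibleSplitting)

/-- `slotChi₂` unfolded (definitional). -/
theorem slotChi₂_apply (t : ↥(relNormOneInfUnits (↥(NumberField.maximalRealSubfield (L : Type))) (L : Type))) :
    slotChi₂ V S hGR hGR₂ hGR₃ t =
      ((cmConjLineChar₀ (L : Type) finProdFinEquiv e₁ (frameD V) (frameD_real V) (frameD_ne V) (dW S) (dW_real S) (dW_ne S)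
        (dW' S) (dW'_real S) (dW'_ne S) S.isoGL (isoGL_hg₀ S) hGR hGR₂ hGR₃
        (1, CMCenter (L : Type) (lineVec (L : Type) (dW' S 0)) ((UnitaryGroup.cmAdelicOneEquivRelNormOne (L : Type)).symm (relNormOneInfToIdeles (↥(NumberField.maximalRealSubfield (L : Type))) (L : Type) t))) : ℂˣ) : ℂ) :=
  rfl

/-- `slotChi₃` unfolded (definitional). -/
theorem slotChi₃_apply (t : ↥(relNormOneInfUnits (↥(NumberField.maximalRealSubfield (L : Type))) (L : Type))) :
    slotChi₃ V S hGR hGR₂ hGR₃ t =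
      ((cmConjLineChar₁ (L : Type) finProdFinEquiv e₁ (frameD V) (frameD_real V) (frameD_ne V) (dW S) (dW_real S) (dW_ne S)
        (dW' S) (dW'_real S) (dW'_ne S) S.isoGL (isoGL_hg₀ S) hGR hGR₂ hGR₃
        (1, CMCenter (L : Type) (lineVec (L : Type) (dW' S 1)) ((UnitaryGroup.cmAdelicOneEquivRelNormOne (L : Type)).symm (relNormOneInfToIdeles (↥(NumberField.maximalRealSubfield (L : Type))) (L : Type) t))) : ℂˣ) : ℂ) :=
  rfl

/-- **THE SLOT CHARACTERS ARE THE BIG PAIR'S ↥(relNormOneInfUnits (↥(NumberField.maximalRealSubfield (L : Type))) (L : Type))US EIGENVALUES, conjugated plane** (slots 2 and 3): the conjugated torus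
`(1, g₀·diag(t₀,t₁)·g₀⁻¹)` of `U(dW)(𝔸)` acts on `φ_{N₀}(Φ₂) ⊗″ φ_{N₁}(Φ₃)` through `ω_ψ ∘ s_pair(hGR)` by `(slotChi₂·c₂)(t₀) · (slotChi₃·c₃)(t₁)`. -/
theorem cmPairRep_conjPlaneTorus_lineTensorFin_testFun
    (Φ₂ Φ₃ : SchwartzMap (Fin 3 → NumberField.mixedEmbedding.mixedSpace (↥(NumberField.maximalRealSubfield (L : Type)))) ℂ)
    (x₂ x₃ : Fin 3 → ↥(NumberField.maximalRealSubfield (L : Type)))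
    (c₂ c₃ : ↥(relNormOneInfUnits (↥(NumberField.maximalRealSubfield (L : Type))) (L : Type)) →* ℂ)
    (hctr₂ : ∀ (N : ℕ) (t : ↥(relNormOneInfUnits (↥(NumberField.maximalRealSubfield (L : Type))) (L : Type))),
      cmPairRep (L : Type) e₁ (frameD V) (frameD_real V) (frameD_ne V) (lineVec (L : Type) (dW' S 0)) (fun _ => dW'_real S 0)
          (fun _ => dW'_ne S 0) hGR₂
          (CMCenter (L : Type) (frameD V) ((UnitaryGroup.cmAdelicOneEquivRelNormOne (L : Type)).symm (relNormOneInfToIdeles (↥(NumberField.maximalRealSubfield (L : Type))) (L : Type) t)), 1)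
          (SupplyInstance.testFun (↥(NumberField.maximalRealSubfield (L : Type))) (Fin 3) Φ₂ x₂ N) =
        c₂ t • SupplyInstance.testFun (↥(NumberField.maximalRealSubfield (L : Type))) (Fin 3) Φ₂ x₂ N)
    (hctr₃ : ∀ (N : ℕ) (t : ↥(relNormOneInfUnits (↥(NumberField.maximalRealSubfield (L : Type))) (L : Type))),
      cmPairRep (L : Type) e₁ (frameD V) (frameD_real V) (frameD_ne V) (lineVec (L : Type) (dW' S 1)) (fun _ => dW'_real S 1)
          (fun _ => dW'_ne S 1) hGR₃
          (CMCenter (L : Type) (frameD V) ((UnitaryGroup.cmAdelicOneEquivRelNormOne (L : Type)).symm (relNormOneInfToIdeles (↥(NumberField.maximalRealSubfield (L : Type))) (L : Type) t)), 1)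
          (SupplyInstance.testFun (↥(NumberField.maximalRealSubfield (L : Type))) (Fin 3) Φ₃ x₃ N) =
        c₃ t • SupplyInstance.testFun (↥(NumberField.maximalRealSubfield (L : Type))) (Fin 3) Φ₃ x₃ N)
    (N₀ N₁ : ℕ) (t₀ t₁ : ↥(relNormOneInfUnits (↥(NumberField.maximalRealSubfield (L : Type))) (L : Type))) :
    cmPairRep (L : Type) finProdFinEquiv (frameD V) (frameD_real V) (frameD_ne V) (dW S) (dW_real S) (dW_ne S) hGR
        (1, cmConjPlaneTorusIdeles (L : Type) (dW S) (dW' S) S.isoGL (isoGL_hg₀ S)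
          (relNormOneInfToIdeles (↥(NumberField.maximalRealSubfield (L : Type))) (L : Type) t₀,
            relNormOneInfToIdeles (↥(NumberField.maximalRealSubfield (L : Type))) (L : Type) t₁))
        (cmConjLineTensorFin (L : Type) finProdFinEquiv e₁ (frameD V) (frameD_real V) (frameD_ne V) (dW S) (dW_real S) (dW_ne S)
          (dW' S) (dW'_real S) (dW'_ne S) S.isoGL (isoGL_hg₀ S)
          (SupplyInstance.testFun (↥(NumberField.maximalRealSubfield (L : Type))) (Fin 3) Φ₂ x₂ N₀)
          (SupplyInstance.testFun (↥(NumberField.maximalRealSubfield (L : Type))) (Fin 3) Φ₃ x₃ N₁)) =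
      ((slotChi₂ V S hGR hGR₂ hGR₃ * c₂) t₀ * (slotChi₃ V S hGR hGR₂ hGR₃ * c₃) t₁) •
        cmConjLineTensorFin (L : Type) finProdFinEquiv e₁ (frameD V) (frameD_real V) (frameD_ne V) (dW S) (dW_real S) (dW_ne S)
          (dW' S) (dW'_real S) (dW'_ne S) S.isoGL (isoGL_hg₀ S)
          (SupplyInstance.testFun (↥(NumberField.maximalRealSubfield (L : Type))) (Fin 3) Φ₂ x₂ N₀)
          (SupplyInstance.testFun (↥(NumberField.maximalRealSubfield (L : Type))) (Fin 3) Φ₃ x₃ N₁) := by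
  have h := cmPairRepTwist_conjTorusIdeles_cmConjLineTensorFin (L : Type) finProdFinEquiv e₁ (frameD V) (frameD_real V) (frameD_ne V)
    (dW S) (dW_real S) (dW_ne S) (dW' S) (dW'_real S) (dW'_ne S) S.isoGL (isoGL_hg₀ S) hGR hGR₂ hGR₃ 1 1 1
    (fun _ _ _ => by rw [MonoidHom.one_apply, MonoidHom.one_apply, MonoidHom.one_apply, one_mul]) 1
    (relNormOneInfToIdeles (↥(NumberField.maximalRealSubfield (L : Type))) (L : Type) t₀)
    (relNormOneInfToIdeles (↥(NumberField.maximalRealSubfield (L : Type))) (L : Type) t₁)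
    (SupplyInstance.testFun (↥(NumberField.maximalRealSubfield (L : Type))) (Fin 3) Φ₂ x₂ N₀)
    (SupplyInstance.testFun (↥(NumberField.maximalRealSubfield (L : Type))) (Fin 3) Φ₃ x₃ N₁)
  rw [cmPairRepTwist_apply_eq_smul, MonoidHom.one_apply, Units.val_one, one_smul] at h
  rw [h, cmConjLineRepFin₀_apply_eq_smul_cmPairRep, cmConjLineRepFin₁_apply_eq_smul_cmPairRep, cmPairRep_one_center',
    cmPairRep_one_center', hctr₂, hctr₃, smul_smul, smul_smul, LinearMap.map_smul₂, LinearMap.map_smul, smul_smul]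
  congr 1
  rw [Units.val_mul, Units.val_mul, MonoidHom.one_apply, MonoidHom.one_apply, Units.val_one, one_mul, one_mul,
    MonoidHom.mul_apply, MonoidHom.mul_apply, slotChi₂_apply, slotChi₃_apply]

end ConjPlane

end HodgeCM.Model.ArchSideTerm

end
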